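import Mathlib
import HarnessLib
import HarnessLib.Audit
import Summits.AtomisticToContinuum.Statement
import Literature.Analysis.FluidPDE.HardSphereFlowConstruction

/-!
Route: SpecularLambertianSwap

CLOSED (retired) 2026-08-15T13:46:44Z by operator:999:1257524 — reason: not-a-thesis: assembly does not conclude the sub-problem Statement — note: D-0027 §2.1 audit (human 2026-08-15: routes that do not decide the summit are removed): the assembly concludes `Literature.MathematicalPhysics.KineticTheory.HydrodynamicLimit`, not the sub-problem statement; a NEW conforming route may be opened from the same idea (generated `closes : … → _root_.Hydr. The file is kept as the record of this route; refuted decls are indexed as negative knowledge (`ledger negatives`).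

# Route SpecularLambertianSwap — swap specular for Lambertian contact by contact — Euler for
deterministic spheres from the Lambertian gas plus an exact hybrid identity

X = SwapGap ∧ LambertianEuler ("it suffices to show"), realising card specular-lambertian-swap
(spine; same 'random future'
architecture as card lindeberg-random-future-universality, which is an ALTERNATIVE layer-2
allocation of the same SwapGap and is not
realised here). Introduce the LAMBERTIAN GAS Λ: the collision-by-collision hard-sphere dynamics of
the library
(`Alexander.freeExitTime` / `incomingPairs`: same free flight, same contacts, same partners as the
deterministic flow) in which, at
the k-th contact, the outgoing relative velocity is |g|·n_k with n_k = normalize(ω̂ + ξ̂_k), ξ_k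
i.i.d. standard Gaussian — i.e. n_k has
the cosine (Lambert/Knudsen) law on the outgoing hemisphere about the contact normal ω; pair
momentum and kinetic energy are conserved
exactly and Liouville / global Gibbs laws are invariant. SwapGap (DERANDOMISATION): from the same
local Gibbs data, pre-shock, the laws
of the tested empirical density/momentum/energy fields under the deterministic flow Φ_t and under
Λ_t merge (bounded-Lipschitz test
functions). LambertianEuler: the fields of Λ_t converge in probability to the classical hs-Euler
solution (the random-model theorem,
OVY/FFL/LO class). Then HydrodynamicLimit is two lines of Portmanteau. The deterministic gas is
asked only for SwapGap, whose intended
proof (layer 2) is the card's exact contact-supported Trotter–Lindeberg identity (support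
SwapIdentity, typed) with integrand
(backward W1-equidistribution defect of contact normals: crux ContactNormalEquidistribution, typed)
× (forward noisy linear response of
Λ: not yet filed), closed by a linear Volterra–Gronwall through the collision-anisotropy statistic
(c_L = 1/16 ≠ 0).
Lean: `SwapGap ∧ LambertianEuler`

## Assembly
Portmanteau-type plumbing, provable now: fix profiles, take σ₀ = min of the two; for σ < σ₀, a
classical solution on [0,T), flows Φ,
the t = 0 hypothesis (passed verbatim to both cruxes) and t < T, χ, δ: with the 1-Lipschitz bounded
F(d,m,e) := min(1, min(δ/2,
(|d − ∫χρ_t| − δ/2)₊)) one has min(1,δ/2)·P_N(δ < |density field(Φ_t z) − ∫χρ_t|) ≤ ∫F∘fields∘Φ_t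
dP_N (Markov; P_N is finite) =
∫F∘fields∘Λ_t d(P_N⊗γ^ℕ) + o(1) (SwapGap) ≤ (P_N⊗γ^ℕ)(δ/2 < |density field(Λ_t) − ∫χρ_t|) + o(1) → 0
(LambertianEuler); likewise for
momentum (F of ‖m − ∫χρ_t u_t‖) and energy. This is TendstoHydroFieldsAt at every t < T, i.e.
HydrodynamicLimitFor σ for σ < σ₀(profiles),
hence the conjunct (hydrodynamicLimit_iff). ContactNormalEquidistribution, SwapIdentity,
CollisionMomentBound, LambertianWellPosed enter
only through the layer-2 proof of SwapGap (Two-layer plan).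

Rationale: WHY THIS LINE. The hybrid (Lindeberg–Trotter) argument run over the COLLISION SEQUENCE of the
deterministic trajectory: switching from specular to
Lambertian after the m-th collision and telescoping gives an exact identity whose m-th term is the
angular fluctuation of the
RANDOM-future value function at the m-th deterministic contact (Kac's-program consistency–stability
identity doi:10.1007/s00222-012-0422-3
between two N-body gases rather than N-body vs. limit; Lindeberg swapping
doi:10.1214/009117906000000575). Two smallnesses meet at each
contact and multiply: backward one-curve hyperbolicity of the deterministic flow gives
W1-equidistribution of the contact normal given
everything else (standard pairs, ChernovDolgopyat2009; CanestrariLiveraniOlla2026 for the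
'deterministic chaos supplies the ergodic input'
technology), and forward conservative noise makes the value function Lipschitz in one collision's
outgoing angle (linear response of a
Markov gas, OllaVaradhanYau1993 / FritzFunakiLebowitz1994 / LiveraniOlla1996 class; cosine-law
random reflections keep Liouville invariant,
doi:10.1007/s00205-008-0120-x). Imported: probability (Lindeberg universality,
Kantorovich–Rubinstein duality), smooth ergodic theory
(standard pairs), stochastic interacting particle systems (OVY with noise). What no open route does:
RelEntropyErgodic/ChaoticMixing/
VanishingNoise classify stationary states of (nearly) deterministic dynamics or remove a vanishing
noise; DenseKineticExpansion expands in
collision histories; OneParticleInfluence perturbs initial data; here ALL infinite-time ergodic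
theory lives in a fixed, fully random
comparison gas and the deterministic system contributes only finite-time, one-curve, local
hyperbolicity. Negatives index empty (2026-08-15).

RANKED CRUXES. #2 SwapGap (crux) — DERANDOMISATION GAP (card A1∧A2∧A4 + Volterra–Gronwall, layer-1
form). For continuous profiles a₀, θ₀ > 0, u₀ there is σ₀ > 0 such that for 0 < σ < σ₀, every
classical hs-Euler solution on [0,T), every family of hard-sphere flows Φ_N and local Gibbs data
whose fields converge at t = 0: for every t < T, continuous χ and every 1-Lipschitz F : ℝ × ℝ³ × ℝ →
[−1,1] of the three χ-tested empirical fields, E_(P_N) F(fields(Φ_N,t z)) − E_(P_N ⊗ γ^ℕ)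
F(fields(Λ_N,t(z, ξ))) → 0, where Λ = lflow is the Lambertian flow, written as an inline `let` block
shared verbatim by the items: Cfg N = (N+1)-sphere phase space over 𝕋³, G = torus geometry, ε σ N =
hsDiameter, τ = `Alexander.freeExitTime`, S = free flight, ldir ω ξ = normalize(ω̂+ξ̂) (cosine law
about ω̂ when ξ is standard Gaussian), lpair = momentum/energy-conserving redraw of the pair (i,j)
along ldir, lstep = free flight to the exit time then lpair on the incoming contact pair
(`Alexander.incomingPairs`; identity if τ = ∞) — i.e. the library's `collisionStep` with
`collidePair` replaced by the Lambertian redraw —, lstate/linst/lflow = its iteration driven by ξ_k,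
collision instants and right-continuous flow exactly as
`Alexander.stateAfter/collisionInstant/fwdFlow`, noise = `Measure.infinitePi` of standard Gaussians
on ℝ³, fld = the triple of χ-tested empirical fields, P N = localGibbsLaw. [difficulty:
open-problem] (why it might fail: rate × influence is critical (≍σ²N^(4/3) contacts × O(N^(-4/3))
influence = O(1)): if Λ's stress response to one redirected pair is not O(N^(-4/3))-Lipschitz
uniformly over deterministically evolved states, or the anisotropy Volterra system (c_L = 1/16) does
not close, the gap stays O(σ²).) [doi:10.1007/s00222-012-0422-3, doi:10.1214/009117906000000575,
OllaVaradhanYau1993, doi:10.3934/krm.2018008, doi:10.1007/s10955-024-03353-1]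
#3 LambertianEuler (crux) — EULER FOR THE LAMBERTIAN GAS (card A3 = angular-noise-ladder's
random-model target at p = 0 = lindeberg-random-future-universality crux 3). Same quantifiers as the
conjunct; conclusion: under P_N ⊗ γ^ℕ the χ-tested empirical density, momentum and energy fields of
Λ_N,t converge in probability to ∫χρ_t, ∫χρ_t u_t, ∫χE_t for every t < T. Expected proof: OVY
relative entropy method with the conservative angular collision noise supplying the ergodic
decomposition (stationary translation-invariant finite-entropy states of the infinite Lambertian gas
are mixtures of Gibbs), same EOS p = ρθZ(ρσ³) (Gibbs laws are Λ-invariant). [difficulty: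
open-problem] (why it might fail: true kinetic energy |v|²/2 (HighMomentumCutoff: OVY need bounded
∇(kinetic energy) for the cubic energy-current LD bounds), and the ergodic theorem must come from
noise acting ONLY on collision angles with deterministic partner selection (degenerate; cf.
angles-are-not-enough Prop A).) [OllaVaradhanYau1993, FritzFunakiLebowitz1994, LiveraniOlla1996,
doi:10.1007/s00205-008-0120-x, Rezakhanlou2003]
#4 ContactNormalEquidistribution (crux) — CONDITIONAL W1-EQUIDISTRIBUTION OF CONTACT NORMALS (card
A1, dual/test-function form; first child of the foreseen split of SwapGap, filed now because it is
typable and is the route's whole deterministic input). For profiles, 0 < σ < σ₀, any t ≥ 0 and any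
test functions ψ_N(s, z) with |ψ| ≤ 1, jointly measurable, 1-Lipschitz in the contact normal (under
`rnorm`: re-placing the pair symmetrically about its midpoint at unit normal n): (N+1)^(-4/3) ·
E_(P_N) Σ_(collisions k ≤ t) |g_k|² [ψ_N(t_k, z_k⁻) − ∫ ψ_N(t_k, R_n z_k⁻) κ_(g_k)(dn)] → 0, where
z_k⁻, t_k, g_k are the pre-collisional configuration, instant and incoming relative velocity of the
k-th collision of the library's deterministic construction (lets zpre/tcol/Kt/hit over
`Alexander.stateAfter/collisionInstant/collisionCount`, `contactSet`, `IsIncoming`), and κ_g ∝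
(n·ĝ)₋ dn is the kinematic cosine law (sampled as normalize(−ĝ+ξ̂), ξ Gaussian). Since ψ may depend
on everything, this says: the |g|²-weighted collision average of W1(Law(ω | all other coordinates),
κ_g) tends to 0 — no low-frequency bias of impact geometry, never a density or entropy statement.
[difficulty: XL] (why it might fail: needs f_s to stay a proper standard family along contact
circles UNIFORMLY in N: backward grazing collisions and short flights have unbounded distortion (3-D
astigmatism, BalintEtAl2002), and recollision rings at fixed σ³ could leave an O(σ³) low-harmonic
bias that does not vanish with N.) [ChernovDolgopyat2009, BalintEtAl2002,
CanestrariLiveraniOlla2026, Simanyi2013, GST2013]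
#9 SwapIdentity (support) — THE EXACT HYBRID (TROTTER–LINDEBERG) IDENTITY (card A4(b)). For 0 < σ <
1/2, N, t ≥ 0, bounded measurable F, z in the good set Γ₀ of the library's construction and almost
surely non-accumulating Lambertian continuations (hypotheses): F(Φ_t z) − E_γ F(Λ_t(z,·)) = Σ_(m <
K_t(z)) [ (P⁰_(t−t_(m+1)) F)(collisionStep z_m) − ∫ (P⁰_(t−t_(m+1)) F)(lstep_ξ z_m) γ(dξ) ], with
P⁰_u F(y) := E_γ F(Λ_u(y,·)) (the let PF) and z_m = stateAfter z m: telescoping over the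
deterministic collision sequence (both gases share free flight and exit times, so after the last
deterministic collision before t they agree), restart of the ξ-driven recursion at its first
collision (lstate (ξ_0, ξ') y (k+1) = lstate ξ' (lstep ξ_0 y) k) and Fubini for γ^ℕ ≅ γ ⊗ γ^ℕ
(`Measure.infinitePi`). N + 1 = 2 is the unit test. [difficulty: provable-now]
[doi:10.1007/s00222-012-0422-3, doi:10.1214/009117906000000575, CIP1994]
#9 LambertianWellPosed (support) — ALEXANDER'S THEOREM FOR THE LAMBERTIAN FLOW: for 0 < σ < 1/2 and
every N, (a) (z, ξ) ↦ Λ_t(z, ξ) is measurable for each t; (b) for Liouville ⊗ γ^ℕ-a.e. (z, ξ) every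
finite exit configuration of the ξ-driven recursion is a simple incoming collision, no pair touches
strictly inside a free flight, and the exit times sum to ∞ (the three `FwdGood` clauses for lstate).
Same flux/measure-preservation argument as `torusFlow_ae_good_holds` / `torusFlow_measurable_holds`:
the cosine redraw maps the incoming flux measure |g·ω|dS onto the outgoing one, so Liouville is
Λ-invariant (one-particle random billiards: Comets–Popov–Schütz–Vachkovskaia, Feres). [difficulty:
M] [GST2013, CIP1994, doi:10.1007/s00205-008-0120-x, doi:10.1016/j.ces.2004.01.016]
#9 CollisionMomentBound (support) — A-PRIORI COLLISION FLUX MOMENTS (card A5; module shared with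
card apriori-tails-and-rattlers): for profiles, 0 < σ < σ₀, t ≥ 0 there is C with
E_(P_N)[(N+1)^(-4/3) Σ_(collisions k ≤ t) (1 + |g_k|³)] ≤ C for all N (normalised |g|³-weighted
collision count of the deterministic flow under local Gibbs data; entropy inequality against the
invariant Gibbs law + exponential moments of equilibrium collision fluxes). Makes the sums in
ContactNormalEquidistribution and in the identity O(1). [difficulty: L] [Spohn1991,
KipnisLandim1999, CIP1994]

TWO-LAYER PLAN. SwapGap ⇐ ContactNormalEquidistribution → LambertianLinearResponse → SwapGap, glue =
SwapIdentity + CollisionMomentBound + a linear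
Volterra–Gronwall inequality for the vector (field gaps, collision-anisotropy gaps).
LambertianLinearResponse (card A2, to be typed once
the Lambertian API is a named definition): for P_N-typical pre-collisional z and smooth F of tested
fields, n ↦ (P⁰_(t−s)F)(lpair n z) is
Lipschitz with constant ≤ C|g|²N^(-4/3)(‖F′‖‖∇χ‖+…), its first-order part is −c_L ℓ_s(z):(g′⊗g′)°
with ℓ_s = N^(-4/3)L_s(x) + o(N^(-4/3))
for a deterministic tensor field L_s (linearised hs-Euler propagator applied to a relaxing stress
dipole), and the same with F replaced by
the collision-anisotropy statistics (class closure: finitely many Volterra unknowns; c_L = 1/16).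
LambertianEuler ⇐ MacroErgodicityΛ →
OVYBookkeepingΛ → LambertianEuler (angular-noise-ladder cruxes 1–2 at p = 0). The ALTERNATIVE split
of SwapGap by kinetic screening [S] +
slab equivalence in mean [I] (card lindeberg-random-future-universality) is a separate route sharing
SwapGap/LambertianEuler by signature.

KILL CRITERIA. ¬SwapGap (e.g. event-driven MD: HS(1) vs HS(0) block-field gap from identical local
Gibbs samples NOT decaying like N^(-1/3), or a proof
that the deterministic flux-weighted collision anisotropy stays O(1)) closes the route
`refuted:SwapGap` and refutes card
lindeberg-random-future-universality with it. ¬LambertianEuler (a non-Gibbs translation-invariant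
finite-entropy stationary state of the
Lambertian gas) forces a pivot of the comparison gas to Rezakhanlou's partner-randomised stochastic
Enskog process (card variant; SwapGap
restated, c_L = 0). ¬ContactNormalEquidistribution (an O(1) low-harmonic bias of ω surviving
collision averaging) kills the card's
layer-2 allocation only: pivot SwapGap's split to [S]+[I]. HydrodynamicLimit proved by any entropy
route moots SwapGap but leaves
LambertianEuler/ContactNormalEquidistribution as independently wanted statements.

NOT DECOMPOSED YET. LambertianLinearResponse (A2) and the Volterra–Gronwall glue (need the
Lambertian API as a named definition and the stress-response
field L_s); the exceptional class of ContactNormalEquidistribution (grazing/short backward flights: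
must sit in the Gronwall constant,
not the forcing); velocity-tail truncations inside LambertianEuler; the N + 1 = 2 unit test of
SwapIdentity; smooth-vs-continuous χ and
bounded-Lipschitz-vs-smooth F approximations (layer-2 support, provable now).

CHEAPEST FALSIFIER. (i) Analytic, done here: the cosine-law second moment — with ω kinematically
distributed, specular outgoing directions are isotropic
(E nnᵀ = I/3) while Lambertian ones give E nnᵀ = (5/16)I + (1/16)ĝĝᵀ, so c_L = 1/16 ≠ 0: the
anisotropy channel is real and the
Volterra closure is genuinely needed (consistent with the card; not a kill). (ii) Provable-now unit
test: SwapIdentity for N + 1 = 2 on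
𝕋³ (everything explicit). (iii) The decisive cheap experiment (kit, when available): event-driven
MD, φ = 0.05–0.2, N = 10³–10⁵, HS(1)
and HS(0) from identical local-Gibbs samples (sinusoidal shear + temperature wave): low-Fourier-mode
momentum/energy gap vs N must decay
like Kn = N^(-1/3); histogram of ω relative to ĝ over real collisions tested against the 5 lowest
zonal harmonics must show no O(1) bias.

NUMBERS. Fixed reduced density: (N+1)ε³ = σ³; mean free path ℓ ≍ N^(-1/3)/σ² (Kn ≍ N^(-1/3));
collisions per particle per unit time ≍ σ²N^(1/3),
in total ≍ σ²N^(4/3) on [0,t]; instantaneous change of conserved χ-fields by one redirected pair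
O(ε|g|‖∇χ‖/N), time-integrated flux
perturbation O(|g|²N^(-4/3)/σ²·σ²) ⇒ rate × influence = O(1) (critical; closed by Gronwall, not term
by term). c_L = 1/16 (above).
OVY 1993 Thm 1.1: Euler with noise for bounded-velocity Hamiltonians (the class LambertianEuler must
leave). Items at open: 7.

DEFINITION REQUESTS. LambertianHardSphereFlow API as named definitions (new object posited for this
problem; topic Summits/AtomisticToContinuum/
HydrodynamicLimit/Theorems): `lambertDir ω ξ`, `lambertPair i j z ξ`, `lambertStep`,
`lambertStateAfter`, `lambertInstant`,
`lambertCount`, `lambertFlow`, `lambertNoise` — verbatim the `let` block of SwapGap — so that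
SwapGap/LambertianEuler/SwapIdentity/
LambertianWellPosed can be restated with short signatures and LambertianLinearResponse typed. Filed
with `ledger workitem add --kind
definition` after open. No cite facts needed: Alexander's theorem on 𝕋³ is PROVED in the tree
(torusFlow_*_holds, flow_eq_ae_holds).

Novelty: Searches (2026-08-15): `lit search --source crossref "Lindeberg principle universality Markov
process swapping"` (8; Chatterjee 2006
doi:10.1214/009117906000000575, rest noise); `lit search --source crossref "billiards random
reflections cosine law Knudsen"` (8: Feres–Yablonsky
doi:10.1016/j.ces.2004.01.016, Comets–Popov–Schütz–Vachkovskaia doi:10.1007/s00205-008-0120-x,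
Chumley–Feres doi:10.1137/20m1349552 — ONE
particle, random WALL reflections; no N-body pair version, no comparison with the specular gas);
`lit search --source crossref "stochastic
billiards Lambertian reflection ergodicity"` (Cook–Feres doi:10.1088/0951-7715/25/9/2503); `lit
frontier AtomisticToContinuum --since 2020`
(30 rows; relevant: CanestrariLiveraniOlla2026 = arXiv:2310.13338, heat equation from a
deterministic dynamics by standard-pair technology);
`lit bridges AtomisticToContinuum --cross any` (nothing on comparison dynamics); `lit galaxy search
… --star all` (panama 0 hits, pdf/crabby
queued out); local `lit search`/vsearch daemon down this session (connection reset), openalex 429 —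
recorded in NOTES. Plus the card's own
audit (refuter T9): nearest printed deterministic-vs-Markov comparison engines
doi:10.3934/krm.2018008 (Matthies–Stone–Theil 2018) and
doi:10.1007/s10955-024-03353-1 (Fougères 2024), both Rayleigh gas / Boltzmann–Grad / linear.
Nearest prior art found: doi:10.1007/s00222-012-0422-3 (Mischler–Mouhot, Kac's program: the same
semigroup-difference identity, N-body
Markov vs. limit equ  [refs: 10.1214/009117906000000575, 10.1016/j.ces.2004.01.016, 10.1007/s00205-008-0120-x, 10.1137/20m1349552, 10.1088/0951-7715/25/9/2503, 10.3934/krm.2018008, 10.1007/s10955-024-03353-1, 10.1007/s00222-012-0422-3, 2310.13338, doi:10.1214/009117906000000575, doi:10.1016/j.ces.2004.01.016, doi:10.1007/s00205-008-0120-x, doi:10.1137/20m1349552, doi:10.1088/0951-7715/25/9/2503, doi:10.3934/krm.2018008, doi:1]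

Barriers (technique_class: lindeberg-swap semigroup-interpolation standard-pairs): - technique_class: lindeberg-swap semigroup-interpolation standard-pairs
- Literature.Barriers.AtomisticToContinuum.BoltzmannHypothesisBarrier: the classification of
stationary states is consumed ONLY inside LambertianEuler, for the Lambertian gas, whose
conservative collision noise is the barrier's own evasion (i) (FFL94/LO96 class); for the
deterministic gas no invariant-measure statement is used — only finite-time one-curve
equidistribution (ContactNormalEquidistribution). The ideal-gas witness is respected: without
collisions SwapIdentity's right side is 0 = 0, Λ = Φ = free flight and LambertianEuler fails,
correctly (card LRFU's σ = 0 oracle).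
- Literature.Barriers.AtomisticToContinuum.BoltzmannHypothesisBarrierNarrow: same slot; met only by
the noisy gas.
- Literature.Barriers.AtomisticToContinuum.MacroErgodicityBarrier: Euler scale, noise present
exactly where ergodicity is invoked; its diffusive clauses are not met.
- Literature.Barriers.AtomisticToContinuum.HighMomentumCutoffBarrier: it does not evade it; the bet
is that for the Lambertian gas (angular averaging built into the dynamics) Povzner-type tail control
with the true kinetic energy is provable — flagged in LambertianEuler's why-line; |g|³ weights in
CollisionMomentBound.
- Literature.Barriers.AtomisticToContinuum.VelocityReversalBarrier: not met — every statement is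
law-level (in probability / in expectation under local Gibbs data); the identity is time-oriented by
construction (deterministic past, random fu

History (route lifecycle, newest last):
- 2026-08-15T13:46:44Z · CLOSED retired — not-a-thesis: assembly does not conclude the sub-problem Statement (operator:999:1257524)

sub-problem: HydrodynamicLimit · status: closed(retired) · opened planner-plancard-AtomisticToContinuum-Hydrody-b8438c6b-0 2026-08-15T11:33:48Z · rev 0 · ledger route-AtomisticToContinuum-SpecularLambertianSwap
GENERATED by the gate from the ledger (D-0016/17). Provers cite these decls: `theorem foo : Summit.AtomisticToContinuum.HydrodynamicLimit.Theses.SpecularLambertianSwap.<Decl> := …` in Summits/AtomisticToContinuum/HydrodynamicLimit/Theorems/<Name>.lean.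
-/

namespace Summit.AtomisticToContinuum.HydrodynamicLimit.Theses.SpecularLambertianSwap

open scoped BigOperators Topology Manifold Classical MeasureTheory ProbabilityTheory Matrix InnerProductSpace ComplexConjugate ContinuousMap
open Filter Set Function TopologicalSpace MeasureTheory

attribute [summit_statement] _root_.HydrodynamicLimit

/-- item stmt-AtomisticToContinuum-4433 · crux · rank 2 · closed · moot by None · by planner
why it might fail: rate × influence is critical (≍σ²N^(4/3) contacts × O(N^(-4/3)) influence = O(1)): if Λ's stress response to one redirected pair is not O(N^(-4/3))-Lipschitz uniformly over deterministically evolved states, or the anisotropy Volterra system (c_L = 1/16) does not close, the gap stays O(σ²).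
sources: doi:10.1007/s00222-012-0422-3, doi:10.1214/009117906000000575, OllaVaradhanYau1993, doi:10.3934/krm.2018008, doi:10.1007/s10955-024-03353-1
[crux] DERANDOMISATION GAP (card A1∧A2∧A4 + Volterra–Gronwall, layer-1 form). For continuous
profiles a₀, θ₀ > 0, u₀ there is σ₀ > 0 such that for 0 < σ < σ₀, every classical hs-Euler solution
on [0,T), every family of hard-sphere flows Φ_N and local Gibbs data whose fields converge at t = 0:
for every t < T, continuous χ and every 1-Lipschitz F : ℝ × ℝ³ × ℝ → [−1,1] of the three χ-tested
empirical fields, E_(P_N) F(fields(Φ_N,t z)) − E_(P_N ⊗ γ^ℕ) F(fields(Λ_N,t(z, ξ))) → 0, where Λ =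
lflow is the Lambertian flow, written as an inline `let` block shared verbatim by the items: Cfg N =
(N+1)-sphere phase space over 𝕋³, G = torus geometry, ε σ N = hsDiameter, τ =
`Alexander.freeExitTime`, S = free flight, ldir ω ξ = normalize(ω̂+ξ̂) (cosine law about ω̂ when ξ
is standard Gaussian), lpair = momentum/energy-conserving redraw of the pair (i,j) along ldir, lstep
= free flight to the exit time then lpair on the incoming contact pair (`Alexander.incomingPairs`;
identity if τ = ∞) — i.e. the library's `collisionStep` with `collidePair` replaced by the
Lambertian redraw —, lstate/linst/lflow = its iteration driven by ξ_k, collision instants and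
right-continuous flow exactly as `Alexander.st -/
@[route_item "route-AtomisticToContinuum-SpecularLambertianSwap"]
def SwapGap : Prop :=
  let Cfg : ℕ → Type := fun N => Literature.Analysis.FluidPDE.Config (N + 1) (Fin 3) (UnitAddTorus (Fin 3)); let G := Literature.Analysis.FluidPDE.Torus.geometry (Fin 3); let ε : ℝ → ℕ → ℝ := Literature.MathematicalPhysics.KineticTheory.hsDiameter; let τ : ℝ → (N : ℕ) → Cfg N → ENNReal := fun σ N z => Literature.Analysis.FluidPDE.Alexander.freeExitTime G (ε σ N) z; let S : ℝ → (N : ℕ) → Cfg N → Cfg N := fun t _ z => Literature.Analysis.FluidPDE.freeFlight G t z; let ldir : EuclideanSpace ℝ (Fin 3) → EuclideanSpace ℝ (Fin 3) → EuclideanSpace ℝ (Fin 3) := fun ω ξ => ‖‖ω‖⁻¹ • ω + ‖ξ‖⁻¹ • ξ‖⁻¹ • (‖ω‖⁻¹ • ω + ‖ξ‖⁻¹ • ξ); let lpair : (N : ℕ) → Fin (N + 1) → Fin (N + 1) → Cfg N → EuclideanSpace ℝ (Fin 3) → Cfg N := fun _ i j z ξ => let c := (2 : ℝ)⁻¹ •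 ((z i).2 + (z j).2); let w := (‖(z i).2 - (z j).2‖ / 2) • ldir (G.sepVec (z i).1 (z j).1) ξ; Function.update (Function.update z i ((z i).1, c + w)) j ((z j).1, c - w); let lstep : ℝ → (N : ℕ) → EuclideanSpace ℝ (Fin 3) → Cfg N → Cfg N := fun σ N ξ z => let z' := S (τ σ N z).toReal N z; if τ σ N z = ⊤ then z else if h : (Literature.Analysis.FluidPDE.Alexander.incomingPairs G (ε σ N) z').Nonempty then lpair N h.some.1 h.some.2 z' ξ else z'; let lstate : ℝ → (N : ℕ) → (ℕ → EuclideanSpace ℝ (Fin 3)) → Cfg N → ℕ → Cfg N := fun σ N ξs z k => ((fun p : Cfg N × ℕ => (lstep σ N (ξs p.2) p.1, p.2 + 1))^[k] (z, 0)).1; let linst : ℝ → (N : ℕ) → (ℕ → EuclideanSpace ℝ (Fin 3)) → Cfg N → ℕ → ENNReal := fun σ N ξs z k => ∑ m ∈ Finset.range k, τ σ N (lstate σ N ξs z m); let lflow : ℝ → (N : ℕ) → (ℕ → EuclideanSpace ℝ (Fin 3)) → Cfg N → ℝ → Cfg N := fun σ N ξs z t => let K := sSup {k : ℕ | linst σ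 N ξs z k ≤ ENNReal.ofReal t}; S (t - (linst σ N ξs z K).toReal) N (lstate σ N ξs z K); let noise : MeasureTheory.Measure (ℕ → EuclideanSpace ℝ (Fin 3)) := MeasureTheory.Measure.infinitePi (fun _ : ℕ => ProbabilityTheory.stdGaussian (EuclideanSpace ℝ (Fin 3))); let fld : (N : ℕ) → Cfg N → ((UnitAddTorus (Fin 3)) → ℝ) → ℝ × (EuclideanSpace ℝ (Fin 3)) × ℝ := fun _ z χ => (Literature.MathematicalPhysics.KineticTheory.empiricalDensityField z χ, Literature.MathematicalPhysics.KineticTheory.empiricalMomentumField z χ, Literature.MathematicalPhysics.KineticTheory.empiricalEnergyField z χ); ∀ (a₀ θ₀ : (UnitAddTorus (Fin 3)) → ℝ) (u₀ : (UnitAddTorus (Fin 3)) → EuclideanSpace ℝ (Fin 3)), Continuous a₀ → Continuous θ₀ → Continuous u₀ → (∀ x, 0 < a₀ x) → (∀ x, 0 < θ₀ x) → ∃ σ₀ : ℝ, 0 < σ₀ ∧ ∀ σ : ℝ, 0 < σ → σ < σ₀ → ∀ (T : ℝ) (ρ θ : ℝ → (UnitAddTorus (Fin 3)) → ℝ) (u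 : ℝ → (UnitAddTorus (Fin 3)) → EuclideanSpace ℝ (Fin 3)), Literature.MathematicalPhysics.KineticTheory.IsHardSphereEulerSolution σ T ρ u θ → ∀ Φ : (N : ℕ) → Literature.Analysis.FluidPDE.HardSphereFlow G (ε σ N) (N + 1), let P := fun N => Literature.MathematicalPhysics.KineticTheory.localGibbsLaw σ a₀ u₀ θ₀ N (Φ N); Literature.MathematicalPhysics.KineticTheory.TendstoHydroFieldsAt P Φ ρ u θ 0 → ∀ t ∈ Set.Ico 0 T, ∀ χ : (UnitAddTorus (Fin 3)) → ℝ, Continuous χ → ∀ F : ℝ × (EuclideanSpace ℝ (Fin 3)) × ℝ → ℝ, LipschitzWith 1 F → (∀ y, |F y| ≤ 1) → Filter.Tendsto (fun N : ℕ => (∫ z, F (fld N ((Φ N).flow t z) χ) ∂(P N)) - ∫ p, F (fld N (lflow σ N p.2 p.1 t) χ) ∂((P N).prod noise)) Filter.atTop (nhds 0)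

/-- item stmt-AtomisticToContinuum-4434 · crux · rank 3 · closed · moot by None · by planner
why it might fail: true kinetic energy |v|²/2 (HighMomentumCutoff: OVY need bounded ∇(kinetic energy) for the cubic energy-current LD bounds), and the ergodic theorem must come from noise acting ONLY on collision angles with deterministic partner selection (degenerate; cf. angles-are-not-enough Prop A).
sources: OllaVaradhanYau1993, FritzFunakiLebowitz1994, LiveraniOlla1996, doi:10.1007/s00205-008-0120-x, Rezakhanlou2003
[crux] EULER FOR THE LAMBERTIAN GAS (card A3 = angular-noise-ladder's random-model target at p = 0 =
lindeberg-random-future-universality crux 3). Same quantifiers as the conjunct; conclusion: under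
P_N ⊗ γ^ℕ the χ-tested empirical density, momentum and energy fields of Λ_N,t converge in
probability to ∫χρ_t, ∫χρ_t u_t, ∫χE_t for every t < T. Expected proof: OVY relative entropy method
with the conservative angular collision noise supplying the ergodic decomposition (stationary
translation-invariant finite-entropy states of the infinite Lambertian gas are mixtures of Gibbs),
same EOS p = ρθZ(ρσ³) (Gibbs laws are Λ-invariant). [difficulty: open-problem] -/
@[route_item "route-AtomisticToContinuum-SpecularLambertianSwap"]
def LambertianEuler : Prop :=
  let Cfg : ℕ → Type := fun N => Literature.Analysis.FluidPDE.Config (N + 1) (Fin 3) (UnitAddTorus (Fin 3)); let G := Literature.Analysis.FluidPDE.Torus.geometry (Fin 3); let ε : ℝ → ℕ → ℝ := Literature.MathematicalPhysics.KineticTheory.hsDiameter; let τ : ℝ → (N : ℕ) → Cfg N → ENNReal := fun σ N z => Literature.Analysis.FluidPDE.Alexander.freeExitTime G (ε σ N) z; let S : ℝ → (N : ℕ) → Cfg N → Cfg N := fun t _ z => Literature.Analysis.FluidPDE.freeFlight G t z; let ldir : EuclideanSpace ℝ (Fin 3) → EuclideanSpace ℝ (Fin 3) → EuclideanSpace ℝ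 (Fin 3) := fun ω ξ => ‖‖ω‖⁻¹ • ω + ‖ξ‖⁻¹ • ξ‖⁻¹ • (‖ω‖⁻¹ • ω + ‖ξ‖⁻¹ • ξ); let lpair : (N : ℕ) → Fin (N + 1) → Fin (N + 1) → Cfg N → EuclideanSpace ℝ (Fin 3) → Cfg N := fun _ i j z ξ => let c := (2 : ℝ)⁻¹ • ((z i).2 + (z j).2); let w := (‖(z i).2 - (z j).2‖ / 2) • ldir (G.sepVec (z i).1 (z j).1) ξ; Function.update (Function.update z i ((z i).1, c + w)) j ((z j).1, c - w); let lstep : ℝ → (N : ℕ) → EuclideanSpace ℝ (Fin 3) → Cfg N → Cfg N := fun σ N ξ z => let z' := S (τ σ N z).toReal N z; if τ σ N z = ⊤ then z else if h : (Literature.Analysis.FluidPDE.Alexander.incomingPairs G (ε σ N) z').Nonempty then lpair N h.some.1 h.some.2 z' ξ else z'; let lstate : ℝ → (N : ℕ) → (ℕ → EuclideanSpace ℝ (Fin 3)) → Cfg N → ℕ → Cfg N := fun σ N ξs z k => ((fun p : Cfg N × ℕ => (lstep σ N (ξs p.2) p.1, p.2 + 1))^[k] (z, 0)).1; let linst : ℝ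 → (N : ℕ) → (ℕ → EuclideanSpace ℝ (Fin 3)) → Cfg N → ℕ → ENNReal := fun σ N ξs z k => ∑ m ∈ Finset.range k, τ σ N (lstate σ N ξs z m); let lflow : ℝ → (N : ℕ) → (ℕ → EuclideanSpace ℝ (Fin 3)) → Cfg N → ℝ → Cfg N := fun σ N ξs z t => let K := sSup {k : ℕ | linst σ N ξs z k ≤ ENNReal.ofReal t}; S (t - (linst σ N ξs z K).toReal) N (lstate σ N ξs z K); let noise : MeasureTheory.Measure (ℕ → EuclideanSpace ℝ (Fin 3)) := MeasureTheory.Measure.infinitePi (fun _ : ℕ => ProbabilityTheory.stdGaussian (EuclideanSpace ℝ (Fin 3))); ∀ (a₀ θ₀ : (UnitAddTorus (Fin 3)) → ℝ) (u₀ : (UnitAddTorus (Fin 3)) → EuclideanSpace ℝ (Fin 3)), Continuous a₀ → Continuous θ₀ → Continuous u₀ → (∀ x, 0 < a₀ x) → (∀ x, 0 < θ₀ x) → ∃ σ₀ : ℝ, 0 < σ₀ ∧ ∀ σ : ℝ, 0 < σ → σ < σ₀ → ∀ (T : ℝ) (ρ θ : ℝ → (UnitAddTorus (Fin 3)) → ℝ)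 (u : ℝ → (UnitAddTorus (Fin 3)) → EuclideanSpace ℝ (Fin 3)), Literature.MathematicalPhysics.KineticTheory.IsHardSphereEulerSolution σ T ρ u θ → ∀ Φ : (N : ℕ) → Literature.Analysis.FluidPDE.HardSphereFlow G (ε σ N) (N + 1), let P := fun N => Literature.MathematicalPhysics.KineticTheory.localGibbsLaw σ a₀ u₀ θ₀ N (Φ N); Literature.MathematicalPhysics.KineticTheory.TendstoHydroFieldsAt P Φ ρ u θ 0 → ∀ t ∈ Set.Ico 0 T, ∀ χ : (UnitAddTorus (Fin 3)) → ℝ, Continuous χ → ∀ δ > (0 : ℝ), Filter.Tendsto (fun N : ℕ => ((P N).prod noise) {p | δ < |Literature.MathematicalPhysics.KineticTheory.empiricalDensityField (lflow σ N p.2 p.1 t) χ - ∫ x, χ x * ρ t x|}) Filter.atTop (nhds 0) ∧ Filter.Tendsto (fun N : ℕ => ((P N).prod noise) {p | δ < ‖Literature.MathematicalPhysics.KineticTheory.empiricalMomentumField (lflow σ N p.2 p.1 t) χ - ∫ x, (χ x * ρ t x) • u t x‖}) Filter.atTop (nhds 0) ∧ Filter.Tendsto (fun N : ℕ => ((P N).prod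 noise) {p | δ < |Literature.MathematicalPhysics.KineticTheory.empiricalEnergyField (lflow σ N p.2 p.1 t) χ - ∫ x, χ x * Literature.MathematicalPhysics.KineticTheory.totalEnergyDensity (ρ t x) (u t x) (θ t x)|}) Filter.atTop (nhds 0)

/-- item stmt-AtomisticToContinuum-4435 · crux · rank 4 · closed · moot by None · by planner
why it might fail: needs f_s to stay a proper standard family along contact circles UNIFORMLY in N: backward grazing collisions and short flights have unbounded distortion (3-D astigmatism, BalintEtAl2002), and recollision rings at fixed σ³ could leave an O(σ³) low-harmonic bias that does not vanish with N.
sources: ChernovDolgopyat2009, BalintEtAl2002, CanestrariLiveraniOlla2026, Simanyi2013, GST2013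
[crux] CONDITIONAL W1-EQUIDISTRIBUTION OF CONTACT NORMALS (card A1, dual/test-function form; first
child of the foreseen split of SwapGap, filed now because it is typable and is the route's whole
deterministic input). For profiles, 0 < σ < σ₀, any t ≥ 0 and any test functions ψ_N(s, z) with |ψ|
≤ 1, jointly measurable, 1-Lipschitz in the contact normal (under `rnorm`: re-placing the pair
symmetrically about its midpoint at unit normal n): (N+1)^(-4/3) · E_(P_N) Σ_(collisions k ≤ t)
|g_k|² [ψ_N(t_k, z_k⁻) − ∫ ψ_N(t_k, R_n z_k⁻) κ_(g_k)(dn)] → 0, where z_k⁻, t_k, g_k are the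
pre-collisional configuration, instant and incoming relative velocity of the k-th collision of the
library's deterministic construction (lets zpre/tcol/Kt/hit over
`Alexander.stateAfter/collisionInstant/collisionCount`, `contactSet`, `IsIncoming`), and κ_g ∝
(n·ĝ)₋ dn is the kinematic cosine law (sampled as normalize(−ĝ+ξ̂), ξ Gaussian). Since ψ may depend
on everything, this says: the |g|²-weighted collision average of W1(Law(ω | all other coordinates),
κ_g) tends to 0 — no low-frequency bias of impact geometry, never a density or entropy statement.
[difficulty: XL] -/
@[route_item "route-AtomisticToContinuum-SpecularLambertianSwap"]
def ContactNormalEquidistribution : Prop :=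
  let Cfg : ℕ → Type := fun N => Literature.Analysis.FluidPDE.Config (N + 1) (Fin 3) (UnitAddTorus (Fin 3)); let G := Literature.Analysis.FluidPDE.Torus.geometry (Fin 3); let ε : ℝ → ℕ → ℝ := Literature.MathematicalPhysics.KineticTheory.hsDiameter; let τ : ℝ → (N : ℕ) → Cfg N → ENNReal := fun σ N z => Literature.Analysis.FluidPDE.Alexander.freeExitTime G (ε σ N) z; let S : ℝ → (N : ℕ) → Cfg N → Cfg N := fun t _ z => Literature.Analysis.FluidPDE.freeFlight G t z; let ldir : EuclideanSpace ℝ (Fin 3) → EuclideanSpace ℝ (Fin 3) → EuclideanSpace ℝ (Fin 3) := fun ω ξ => ‖‖ω‖⁻¹ • ω + ‖ξ‖⁻¹ • ξ‖⁻¹ • (‖ω‖⁻¹ • ω + ‖ξ‖⁻¹ • ξ); let zpre : ℝ → (N : ℕ) → Cfg N → ℕ → Cfg N := fun σ N z m => let y := Literature.Analysis.FluidPDE.Alexander.stateAfter G (ε σ N) z m; S (τ σ N y).toReal N y; let Kt : ℝ → (N : ℕ) → Cfg N → ℝ → ℕ := fun σ N z t => Literature.Analysis.FluidPDE.Alexander.collisionCount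 G (ε σ N) z t; let hit : ℝ → (N : ℕ) → Cfg N → Fin (N + 1) → Fin (N + 1) → Prop := fun σ N y i j => i < j ∧ y ∈ Literature.Analysis.FluidPDE.contactSet G (N + 1) (ε σ N) i j ∧ Literature.Analysis.FluidPDE.IsIncoming G y i j; let tcol : ℝ → (N : ℕ) → Cfg N → ℕ → ℝ := fun σ N z m => (Literature.Analysis.FluidPDE.Alexander.collisionInstant G (ε σ N) z (m + 1)).toReal; let rnorm : ℝ → (N : ℕ) → Fin (N + 1) → Fin (N + 1) → EuclideanSpace ℝ (Fin 3) → Cfg N → Cfg N := fun σ N i j n z => let c := G.translate (z j).1 ((2 : ℝ)⁻¹ • G.sepVec (z i).1 (z j).1); let w := (ε σ N / 2) • n; Function.update (Function.update z i (G.translate c w, (z i).2)) j (G.translate c (-w), (z j).2); ∀ (a₀ θ₀ : (UnitAddTorus (Fin 3)) → ℝ) (u₀ : (UnitAddTorus (Fin 3)) → EuclideanSpace ℝ (Fin 3)), Continuous a₀ → Continuous θ₀ → Continuous u₀ → (∀ x, 0 < a₀ x) → (∀ x, 0 < θ₀ x) → ∃ σ₀ : ℝ, 0 < σ₀ ∧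 ∀ σ : ℝ, 0 < σ → σ < σ₀ → ∀ Φ : (N : ℕ) → Literature.Analysis.FluidPDE.HardSphereFlow G (ε σ N) (N + 1), let P := fun N => Literature.MathematicalPhysics.KineticTheory.localGibbsLaw σ a₀ u₀ θ₀ N (Φ N); ∀ t : ℝ, 0 ≤ t → ∀ ψ : (N : ℕ) → ℝ → Cfg N → ℝ, (∀ N, Measurable (Function.uncurry (ψ N))) → (∀ N s z, |ψ N s z| ≤ 1) → (∀ N s z (i j : Fin (N + 1)) (n n' : EuclideanSpace ℝ (Fin 3)), ‖n‖ = 1 → ‖n'‖ = 1 → |ψ N s (rnorm σ N i j n z) - ψ N s (rnorm σ N i j n' z)| ≤ ‖n - n'‖) → Filter.Tendsto (fun N : ℕ => ∫ z, ((N : ℝ) + 1) ^ (-(4 / 3 : ℝ)) * ∑ m ∈ Finset.range (Kt σ N z t), ∑ i : Fin (N + 1), ∑ j : Fin (N + 1), (let y := zpre σ N z m; if hit σ N y i j then ‖((y i).2 - (y j).2)‖ ^ 2 * (ψ N (tcol σ N z m) y - ∫ ξ, ψ N (tcol σ N z m) (rnorm σ N i j (ldir (-((y i).2 - (y j).2))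 ξ) y) ∂(ProbabilityTheory.stdGaussian (EuclideanSpace ℝ (Fin 3)))) else 0) ∂(P N)) Filter.atTop (nhds 0)

/-- item stmt-AtomisticToContinuum-4441 · support · rank 9 · closed · moot by None · by planner
sources: doi:10.1007/s00222-012-0422-3, doi:10.1214/009117906000000575, CIP1994
[support] THE EXACT HYBRID (TROTTER–LINDEBERG) IDENTITY (card A4(b)). For 0 < σ < 1/2, N, t ≥ 0,
bounded measurable F, z in the good set Γ₀ of the library's construction and almost surely
non-accumulating Lambertian continuations (hypotheses): F(Φ_t z) − E_γ F(Λ_t(z,·)) = Σ_(m < K_t(z))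
[ (P⁰_(t−t_(m+1)) F)(collisionStep z_m) − ∫ (P⁰_(t−t_(m+1)) F)(lstep_ξ z_m) γ(dξ) ], with P⁰_u F(y)
:= E_γ F(Λ_u(y,·)) (the let PF) and z_m = stateAfter z m: telescoping over the deterministic
collision sequence (both gases share free flight and exit times, so after the last deterministic
collision before t they agree), restart of the ξ-driven recursion at its first collision (lstate
(ξ_0, ξ') y (k+1) = lstate ξ' (lstep ξ_0 y) k) and Fubini for γ^ℕ ≅ γ ⊗ γ^ℕ (`Measure.infinitePi`).
N + 1 = 2 is the unit test. [difficulty: provable-now] -/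
@[route_item "route-AtomisticToContinuum-SpecularLambertianSwap"]
def SwapIdentity : Prop :=
  let Cfg : ℕ → Type := fun N => Literature.Analysis.FluidPDE.Config (N + 1) (Fin 3) (UnitAddTorus (Fin 3)); let G := Literature.Analysis.FluidPDE.Torus.geometry (Fin 3); let ε : ℝ → ℕ → ℝ := Literature.MathematicalPhysics.KineticTheory.hsDiameter; let τ : ℝ → (N : ℕ) → Cfg N → ENNReal := fun σ N z => Literature.Analysis.FluidPDE.Alexander.freeExitTime G (ε σ N) z; let S : ℝ → (N : ℕ) → Cfg N → Cfg N := fun t _ z => Literature.Analysis.FluidPDE.freeFlight G t z; let ldir : EuclideanSpace ℝ (Fin 3) → EuclideanSpace ℝ (Fin 3) → EuclideanSpace ℝ (Fin 3) := fun ω ξ => ‖‖ω‖⁻¹ • ω + ‖ξ‖⁻¹ • ξ‖⁻¹ • (‖ω‖⁻¹ • ω + ‖ξ‖⁻¹ • ξ); let lpair : (N : ℕ) → Fin (N + 1) → Fin (N + 1) → Cfg N → EuclideanSpace ℝ (Fin 3) → Cfg N := fun _ i j z ξ => let c := (2 : ℝ)⁻¹ • ((z i).2 + (z j).2); let w :=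 (‖(z i).2 - (z j).2‖ / 2) • ldir (G.sepVec (z i).1 (z j).1) ξ; Function.update (Function.update z i ((z i).1, c + w)) j ((z j).1, c - w); let lstep : ℝ → (N : ℕ) → EuclideanSpace ℝ (Fin 3) → Cfg N → Cfg N := fun σ N ξ z => let z' := S (τ σ N z).toReal N z; if τ σ N z = ⊤ then z else if h : (Literature.Analysis.FluidPDE.Alexander.incomingPairs G (ε σ N) z').Nonempty then lpair N h.some.1 h.some.2 z' ξ else z'; let lstate : ℝ → (N : ℕ) → (ℕ → EuclideanSpace ℝ (Fin 3)) → Cfg N → ℕ → Cfg N := fun σ N ξs z k => ((fun p : Cfg N × ℕ => (lstep σ N (ξs p.2) p.1, p.2 + 1))^[k] (z, 0)).1; let linst : ℝ → (N : ℕ) → (ℕ → EuclideanSpace ℝ (Fin 3)) → Cfg N → ℕ → ENNReal := fun σ N ξs z k => ∑ m ∈ Finset.range k, τ σ N (lstate σ N ξs z m); let lflow : ℝ → (N : ℕ) → (ℕ → EuclideanSpace ℝ (Fin 3)) → Cfg N → ℝ → Cfg N := fun σ N ξs z t => let K := sSup {k : ℕ | linst σ N ξs z k ≤ ENNReal.ofReal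 t}; S (t - (linst σ N ξs z K).toReal) N (lstate σ N ξs z K); let noise : MeasureTheory.Measure (ℕ → EuclideanSpace ℝ (Fin 3)) := MeasureTheory.Measure.infinitePi (fun _ : ℕ => ProbabilityTheory.stdGaussian (EuclideanSpace ℝ (Fin 3))); ∀ σ : ℝ, 0 < σ → σ < 2⁻¹ → ∀ (N : ℕ) (t : ℝ), 0 ≤ t → (∀ s : ℝ, Measurable (fun p : Cfg N × (ℕ → EuclideanSpace ℝ (Fin 3)) => lflow σ N p.2 p.1 s)) → ∀ F : Cfg N → ℝ, Measurable F → (∀ z, |F z| ≤ 1) → ∀ z ∈ Literature.Analysis.FluidPDE.Alexander.good G (ε σ N), (∀ m : ℕ, ∀ᵐ ξs ∂noise, ∑' k, τ σ N (lstate σ N ξs (Literature.Analysis.FluidPDE.Alexander.stateAfter G (ε σ N) z m) k) = ⊤) → (let PF : ℝ → Cfg N → ℝ := fun s y => ∫ ξs, F (lflow σ N ξs y s) ∂noise; F (Literature.Analysis.FluidPDE.Alexander.fwdFlow G (ε σ N) z t) - PF t z = ∑ m ∈ Finset.range (Literature.Analysis.FluidPDE.Alexander.collisionCount G (ε σ N)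 z t), (let s := t - (Literature.Analysis.FluidPDE.Alexander.collisionInstant G (ε σ N) z (m + 1)).toReal; PF s (Literature.Analysis.FluidPDE.Alexander.collisionStep G (ε σ N) (Literature.Analysis.FluidPDE.Alexander.stateAfter G (ε σ N) z m)) - ∫ ξ, PF s (lstep σ N ξ (Literature.Analysis.FluidPDE.Alexander.stateAfter G (ε σ N) z m)) ∂(ProbabilityTheory.stdGaussian (EuclideanSpace ℝ (Fin 3)))))

/-- item stmt-AtomisticToContinuum-4442 · support · rank 9 · closed · moot by None · by planner
sources: GST2013, CIP1994, doi:10.1007/s00205-008-0120-x, doi:10.1016/j.ces.2004.01.016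
[support] ALEXANDER'S THEOREM FOR THE LAMBERTIAN FLOW: for 0 < σ < 1/2 and every N, (a) (z, ξ) ↦
Λ_t(z, ξ) is measurable for each t; (b) for Liouville ⊗ γ^ℕ-a.e. (z, ξ) every finite exit
configuration of the ξ-driven recursion is a simple incoming collision, no pair touches strictly
inside a free flight, and the exit times sum to ∞ (the three `FwdGood` clauses for lstate). Same
flux/measure-preservation argument as `torusFlow_ae_good_holds` / `torusFlow_measurable_holds`: the
cosine redraw maps the incoming flux measure |g·ω|dS onto the outgoing one, so Liouville is
Λ-invariant (one-particle random billiards: Comets–Popov–Schütz–Vachkovskaia, Feres). [difficulty: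
M] -/
@[route_item "route-AtomisticToContinuum-SpecularLambertianSwap"]
def LambertianWellPosed : Prop :=
  let Cfg : ℕ → Type := fun N => Literature.Analysis.FluidPDE.Config (N + 1) (Fin 3) (UnitAddTorus (Fin 3)); let G := Literature.Analysis.FluidPDE.Torus.geometry (Fin 3); let ε : ℝ → ℕ → ℝ := Literature.MathematicalPhysics.KineticTheory.hsDiameter; let τ : ℝ → (N : ℕ) → Cfg N → ENNReal := fun σ N z => Literature.Analysis.FluidPDE.Alexander.freeExitTime G (ε σ N) z; let S : ℝ → (N : ℕ) → Cfg N → Cfg N := fun t _ z => Literature.Analysis.FluidPDE.freeFlight G t z; let ldir : EuclideanSpace ℝ (Fin 3) → EuclideanSpace ℝ (Fin 3) → EuclideanSpace ℝ (Fin 3) := fun ω ξ => ‖‖ω‖⁻¹ • ω + ‖ξ‖⁻¹ • ξ‖⁻¹ • (‖ω‖⁻¹ • ω + ‖ξ‖⁻¹ • ξ); let lpair : (N : ℕ) → Fin (N + 1) → Fin (N + 1) → Cfg N → EuclideanSpace ℝ (Fin 3) → Cfg N := fun _ i j z ξ => let c := (2 : ℝ)⁻¹ • ((z i).2 + (z j).2);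 let w := (‖(z i).2 - (z j).2‖ / 2) • ldir (G.sepVec (z i).1 (z j).1) ξ; Function.update (Function.update z i ((z i).1, c + w)) j ((z j).1, c - w); let lstep : ℝ → (N : ℕ) → EuclideanSpace ℝ (Fin 3) → Cfg N → Cfg N := fun σ N ξ z => let z' := S (τ σ N z).toReal N z; if τ σ N z = ⊤ then z else if h : (Literature.Analysis.FluidPDE.Alexander.incomingPairs G (ε σ N) z').Nonempty then lpair N h.some.1 h.some.2 z' ξ else z'; let lstate : ℝ → (N : ℕ) → (ℕ → EuclideanSpace ℝ (Fin 3)) → Cfg N → ℕ → Cfg N := fun σ N ξs z k => ((fun p : Cfg N × ℕ => (lstep σ N (ξs p.2) p.1, p.2 + 1))^[k] (z, 0)).1; let linst : ℝ → (N : ℕ) → (ℕ → EuclideanSpace ℝ (Fin 3)) → Cfg N → ℕ → ENNReal := fun σ N ξs z k => ∑ m ∈ Finset.range k, τ σ N (lstate σ N ξs z m); let lflow : ℝ → (N : ℕ) → (ℕ → EuclideanSpace ℝ (Fin 3)) → Cfg N → ℝ → Cfg N := fun σ N ξs z t => let K := sSup {k : ℕ | linst σ N ξs z k ≤ ENNReal.ofReal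 t}; S (t - (linst σ N ξs z K).toReal) N (lstate σ N ξs z K); let noise : MeasureTheory.Measure (ℕ → EuclideanSpace ℝ (Fin 3)) := MeasureTheory.Measure.infinitePi (fun _ : ℕ => ProbabilityTheory.stdGaussian (EuclideanSpace ℝ (Fin 3))); ∀ σ : ℝ, 0 < σ → σ < 2⁻¹ → ∀ N : ℕ, (∀ t : ℝ, Measurable (fun p : Cfg N × (ℕ → EuclideanSpace ℝ (Fin 3)) => lflow σ N p.2 p.1 t)) ∧ ∀ᵐ p ∂((Literature.Analysis.FluidPDE.liouville G (N + 1) (ε σ N)).prod noise), (let L := lstate σ N p.2 p.1; ((∀ k, τ σ N (L k) ≠ ⊤ → Literature.Analysis.FluidPDE.Alexander.IsSimpleIncoming G (ε σ N) (S (τ σ N (L k)).toReal N (L k))) ∧ (∀ k (s : ℝ), 0 < s → ENNReal.ofReal s < τ σ N (L k) → ∀ i j : Fin (N + 1), i ≠ j → S s N (L k) ∉ Literature.Analysis.FluidPDE.contactSet G (N + 1) (ε σ N) i j) ∧ ∑' k, τ σ N (L k) = ⊤))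

/-- item stmt-AtomisticToContinuum-4443 · support · rank 9 · closed · moot by None · by planner
sources: Spohn1991, KipnisLandim1999, CIP1994
[support] A-PRIORI COLLISION FLUX MOMENTS (card A5; module shared with card
apriori-tails-and-rattlers): for profiles, 0 < σ < σ₀, t ≥ 0 there is C with E_(P_N)[(N+1)^(-4/3)
Σ_(collisions k ≤ t) (1 + |g_k|³)] ≤ C for all N (normalised |g|³-weighted collision count of the
deterministic flow under local Gibbs data; entropy inequality against the invariant Gibbs law +
exponential moments of equilibrium collision fluxes). Makes the sums in
ContactNormalEquidistribution and in the identity O(1). [difficulty: L] -/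
@[route_item "route-AtomisticToContinuum-SpecularLambertianSwap"]
def CollisionMomentBound : Prop :=
  let Cfg : ℕ → Type := fun N => Literature.Analysis.FluidPDE.Config (N + 1) (Fin 3) (UnitAddTorus (Fin 3)); let G := Literature.Analysis.FluidPDE.Torus.geometry (Fin 3); let ε : ℝ → ℕ → ℝ := Literature.MathematicalPhysics.KineticTheory.hsDiameter; let τ : ℝ → (N : ℕ) → Cfg N → ENNReal := fun σ N z => Literature.Analysis.FluidPDE.Alexander.freeExitTime G (ε σ N) z; let S : ℝ → (N : ℕ) → Cfg N → Cfg N := fun t _ z => Literature.Analysis.FluidPDE.freeFlight G t z; let zpre : ℝ → (N : ℕ) → Cfg N → ℕ → Cfg N := fun σ N z m => let y := Literature.Analysis.FluidPDE.Alexander.stateAfter G (ε σ N) z m; S (τ σ N y).toReal N y; let Kt : ℝ → (N : ℕ) → Cfg N → ℝ → ℕ := fun σ N z t => Literature.Analysis.FluidPDE.Alexander.collisionCount G (ε σ N) z t; let hit : ℝ → (N : ℕ) → Cfg N → Fin (N + 1) → Fin (N + 1) → Prop := fun σ N y i j => i < j ∧ y ∈ Literature.Analysis.FluidPDE.contactSet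 G (N + 1) (ε σ N) i j ∧ Literature.Analysis.FluidPDE.IsIncoming G y i j; ∀ (a₀ θ₀ : (UnitAddTorus (Fin 3)) → ℝ) (u₀ : (UnitAddTorus (Fin 3)) → EuclideanSpace ℝ (Fin 3)), Continuous a₀ → Continuous θ₀ → Continuous u₀ → (∀ x, 0 < a₀ x) → (∀ x, 0 < θ₀ x) → ∃ σ₀ : ℝ, 0 < σ₀ ∧ ∀ σ : ℝ, 0 < σ → σ < σ₀ → ∀ Φ : (N : ℕ) → Literature.Analysis.FluidPDE.HardSphereFlow G (ε σ N) (N + 1), let P := fun N => Literature.MathematicalPhysics.KineticTheory.localGibbsLaw σ a₀ u₀ θ₀ N (Φ N); ∀ t : ℝ, 0 ≤ t → ∃ C : ℝ, ∀ N : ℕ, ∫⁻ z, ENNReal.ofReal (((N : ℝ) + 1) ^ (-(4 / 3 : ℝ)) * ∑ m ∈ Finset.range (Kt σ N z t), ∑ i : Fin (N + 1), ∑ j : Fin (N + 1), (let y := zpre σ N z m; if hit σ N y i j then 1 + ‖((y i).2 - (y j).2)‖ ^ 3 else 0)) ∂(P N) ≤ ENNReal.ofReal C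

/-- item stmt-AtomisticToContinuum-4444 · assembly · rank 1 · closed · moot by None · by planner
sources: OllaVaradhanYau1993, Spohn1991
[assembly] SwapGap → LambertianEuler → HydrodynamicLimit. -/
@[route_item "route-AtomisticToContinuum-SpecularLambertianSwap"]
def Assembly : Prop :=
  SwapGap → LambertianEuler → Literature.MathematicalPhysics.KineticTheory.HydrodynamicLimit

end Summit.AtomisticToContinuum.HydrodynamicLimit.Theses.SpecularLambertianSwap
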